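import Summits.Parity.GeneralizedHardyLittlewood.Theorems.Dhl42MainIPairs

/-!
# DHL[42,2] certificate — `42·J^K(F₀)` in closed form: `42·JKval = pairedJ` (Lemma 6.1(c), §6.2)

First the first-coordinate integral: for `t' ∈ K·R_41`,
`(F₀)₁(t') = Π_j g(t'_j) · (𝖠(σ') + 𝖡(σ') Σ_l η(t'_l))`, `σ' = Σ t'_j`, with the explicit
exp-polynomials `𝖠 = Pep`, `𝖡 = Qep` of `Dhl42ClosedFormSetup` (eq. (Psi): tail integrals of `g`,
`h` against the radial polynomials — `tail_chi`, `tail_PhiCut`, `tail_PhiPoly`, `tail_Phi`,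
`F0marg_eq`). Then `J^K(F₀) = ∫_{K·R_41} (F₀)₁²` has the same class structure as `I(F₀)`
(`integral_classes` with 41 coordinates and weights `𝖠²`, `𝖠𝖡`, `𝖡²` = `WP2`, `WPQ`, `WQ2`):
`JKval_classes : J^K(F₀) = V'_A + 82 V'_B + 41 V'_C + 1640 V'_D`, each class a pairing over `[0, K]`
(`pairing_K`, `VA'_eq` … `VD'_eq`), whence **`JKval42_eq_pairedJ : 42 * JKval = pairedJ`**. The
kernel bridge identifies `pairedJ` with the exact 113-term value `jkSum`.

Origin: `Dhl42/ClosedForm/MainJ.lean` of the DHL[42,2] certificate package (pub-dhl42 bundle,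
archive blob `18cce9e3`; sha256[:16] of the file `ba4f86daad8a00ec`; paper snapshot =
`paper/main.tex` v1), lines :25–:270; statements and proofs unchanged except: namespace
`Dhl42.ClosedForm` → `Summit.Parity.GeneralizedHardyLittlewood.Theorems.Dhl42.ClosedForm`,
`open TpY4Dhl42` dropped (the certificate's Part 1–7 declarations, migrated to
`Summit.Parity.GeneralizedHardyLittlewood.Theorems.Dhl42` in batches B2/B3, are in scope in the
sub-namespace), `Dhl42.ExpPoly` → the tree's `Literature.Analysis.ValidatedNumerics.ExpPoly`
(`ExpPoly/*.lean`, batch B1), the package's `simplexSet n B` replaced by the tree's definitionally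
equal `Literature.NumberTheory.Sieve.scaledSimplex n B` (also inside the names of the B2/B3 lemmas
used), docstrings added where missing. Package-internal references in the verbatim docstrings
(`Density.lean`, `Setup.lean`, `KernelBridge.lean`, `MainI.…`) refer to that package (paper Appendix
B).

Declarations (25): `F0_cons`, `ii_cmul`, `shift_integral`, `tail_chi`, `tail_PhiCut`,
`tail_PhiPoly`, `tail_Phi`, `ii_shift`, `sum_nonneg_of_mem`, `F0marg_eq`, `testFn_of_continuous`,
`testFn_P2`, `testFn_PQ`, `testFn_Q2`, `pairing_K`, `VA'`, `VB'`, `VC'`, `VD'`, `JKval_classes`,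
`VA'_eq`, `VB'_eq`, `VC'_eq`, `VD'_eq`, `JKval42_eq_pairedJ`.
-/

open MeasureTheory Set Filter Real intervalIntegral
open Literature.Analysis.ValidatedNumerics.ExpPoly
open Literature.NumberTheory.Sieve (scaledSimplex measurableSet_scaledSimplex)

namespace Summit.Parity.GeneralizedHardyLittlewood.Theorems.Dhl42.ClosedForm

noncomputable section

/-! ### `F₀` on a fibre `{(s, t')}` -/

/-- `F₀` on a fibre: for `t' ∈ [0,∞)^{41}`, `s ↦ F₀(s, t')` is
`1[0 ≤ s ≤ S − Σ t'] · (Π_j g(t'_j)) · (g(s)Φ(s + Σt') + h(s)χ(s + Σt') + g(s)χ(s + Σt') Σ_l η(t'_l))`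
(Definition of `F₀`, eq. (12), with the first coordinate separated). -/
theorem F0_cons (s : ℝ) (t' : Fin 41 → ℝ) (ht' : ∀ j, 0 ≤ t' j) :
    F0 (Fin.cons s t') = (Icc 0 (Sc - ∑ j, t' j)).indicator
      (fun s => (∏ j, gfun (t' j)) * (gfun s * Phi (s + ∑ j, t' j) + hfun s * chi (s + ∑ j, t' j) +
        gfun s * chi (s + ∑ j, t' j) * ∑ l, hfun (t' l) / gfun (t' l))) s := by
  have hmem := mem_scaledSimplex_cons_iff s t' Sc
  have hprod : ∏ j, gfun ((Fin.cons s t' : Fin 42 → ℝ) j) = gfun s * ∏ j, gfun (t' j) := by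
    rw [Fin.prod_univ_succ]; simp
  have hsum : ∑ j, (Fin.cons s t' : Fin 42 → ℝ) j = s + ∑ j, t' j := sum_cons s t'
  have heta : ∑ l, hfun ((Fin.cons s t' : Fin 42 → ℝ) l) / gfun ((Fin.cons s t' : Fin 42 → ℝ) l) =
      hfun s / gfun s + ∑ l, hfun (t' l) / gfun (t' l) := by
    rw [Fin.sum_univ_succ]; simp
  unfold F0 Rmark
  by_cases hs : s ∈ Icc 0 (Sc - ∑ j, t' j)
  · have hin : (Fin.cons s t' : Fin 42 → ℝ) ∈ scaledSimplex 42 Sc :=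
      hmem.2 ⟨hs.1, ht', by linarith [hs.2]⟩
    rw [indicator_of_mem hin, indicator_of_mem hs, hprod, hsum, heta]
    have hg : gfun s ≠ 0 := (gfun_pos s).ne'
    field_simp
    ring
  · have hout : (Fin.cons s t' : Fin 42 → ℝ) ∉ scaledSimplex 42 Sc := by
      intro h
      have h' := hmem.1 h
      exact hs ⟨h'.1, by linarith [h'.2.2]⟩
    rw [indicator_of_notMem hout, indicator_of_notMem hs]

/-! ### One-dimensional integrals against the radial data -/

/-- Interval integrability of `c(u − σ) ψ(u)` on `[a, b] ⊆ [0, S]`, `c` continuous, `ψ` bounded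
measurable on `[0, S]`. -/
theorem ii_cmul {c ψ : ℝ → ℝ} (hcc : Continuous c) (hψ : Measurable ψ)
    (hψb : ∃ C, 0 ≤ C ∧ ∀ x ∈ Icc 0 Sc, |ψ x| ≤ C) (σ : ℝ) {a b : ℝ} (ha : 0 ≤ a) (hab : a ≤ b)
    (hb : b ≤ Sc) : IntervalIntegrable (fun u => c (u - σ) * ψ u) volume a b := by
  obtain ⟨C, hC0, hC⟩ := hψb
  have hc' : Continuous fun u => c (u - σ) := hcc.comp (continuous_id.sub continuous_const)
  obtain ⟨D, hD0, hD⟩ := exists_bound_Icc_of_continuous hc' a b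
  refine intervalIntegrable_of_bdd (f := fun u => c (u - σ) * ψ u) (hc'.measurable.mul hψ)
    (C := D * C) hab fun x hx => ?_
  rw [abs_mul]
  exact mul_le_mul (hD x hx) (hC x ⟨ha.trans hx.1, hx.2.trans hb⟩) (abs_nonneg _) hD0

/-- `∫_0^{S−σ} c(x) ψ(x+σ) dx = ∫_σ^S c(u−σ) ψ(u) du`. -/
theorem shift_integral (c ψ : ℝ → ℝ) (σ : ℝ) :
    ∫ x in (0 : ℝ)..(Sc - σ), c x * ψ (x + σ) = ∫ u in σ..Sc, c (u - σ) * ψ u := by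
  have h := intervalIntegral.integral_comp_add_right (a := 0) (b := Sc - σ)
    (fun u => c (u - σ) * ψ u) σ
  simp only [add_sub_cancel_right, zero_add, sub_add_cancel] at h
  exact h

/-- `χ`-type tail: `∫_σ^S c(u−σ) χ(u) du = (tailInteg cE χ_K K)(σ)` for `0 ≤ σ ≤ K`. -/
theorem tail_chi {cE : ES} {c : ℝ → ℝ} (hc : ∀ x, ES.eval cE x = c x) (hcc : Continuous c)
    {σ : ℝ} (hσ0 : 0 ≤ σ) (hσ : σ ≤ Kc) :
    ∫ u in σ..Sc, c (u - σ) * chi u = EP.eval (EP.tailInteg cE chiK Kq) σ := by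
  have hi1 := ii_cmul hcc measurable_chi exists_bound_chi σ hσ0 hσ Kc_le_Sc
  have hi2 := ii_cmul hcc measurable_chi exists_bound_chi σ (hσ0.trans hσ) Kc_le_Sc le_rfl
  rw [← integral_add_adjacent_intervals hi1 hi2]
  have hS : ∫ u in Kc..Sc, c (u - σ) * chi u = 0 := by
    rw [integral_of_le Kc_le_Sc,
      setIntegral_congr_fun measurableSet_Ioc (g := fun _ => (0 : ℝ)) fun u hu => by
        simp only [chi_of_gt hu.1, mul_zero]]
    simp
  rw [hS, add_zero, EP.eval_tailInteg, Kq_cast]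
  apply intervalIntegral.integral_congr
  intro u hu
  rw [uIcc_of_le hσ] at hu
  simp only [chi_of_le hu.2, hc]

/-- `Φ`-cutoff tail: `∫_σ^S c(u−σ) 1[u ≤ K] Φ_K(u) du = (tailInteg cE Φ_K K)(σ)` for `0 ≤ σ ≤ K`. -/
theorem tail_PhiCut {cE : ES} {c : ℝ → ℝ} (hc : ∀ x, ES.eval cE x = c x) (hcc : Continuous c)
    {σ : ℝ} (hσ0 : 0 ≤ σ) (hσ : σ ≤ Kc) :
    ∫ u in σ..Sc, c (u - σ) * (if u ≤ Kc then PhiCut u else 0) =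
      EP.eval (EP.tailInteg cE phiK Kq) σ := by
  have hmeas : Measurable fun u : ℝ => if u ≤ Kc then PhiCut u else 0 :=
    Measurable.ite (measurableSet_le measurable_id measurable_const) continuous_PhiCut.measurable
      measurable_const
  have hbdd : ∃ C, 0 ≤ C ∧ ∀ x ∈ Icc 0 Sc, |(if x ≤ Kc then PhiCut x else 0)| ≤ C := by
    obtain ⟨C, hC0, hC⟩ := exists_bound_Icc_of_continuous continuous_PhiCut 0 Sc
    refine ⟨C, hC0, fun x hx => ?_⟩
    split_ifs
    · exact hC x hx
    · simpa using hC0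
  have hi1 := ii_cmul hcc hmeas hbdd σ hσ0 hσ Kc_le_Sc
  have hi2 := ii_cmul hcc hmeas hbdd σ (hσ0.trans hσ) Kc_le_Sc le_rfl
  rw [← integral_add_adjacent_intervals hi1 hi2]
  have hS : ∫ u in Kc..Sc, c (u - σ) * (if u ≤ Kc then PhiCut u else 0) = 0 := by
    rw [integral_of_le Kc_le_Sc,
      setIntegral_congr_fun measurableSet_Ioc (g := fun _ => (0 : ℝ)) fun u hu => by
        simp only [if_neg (not_le.2 hu.1), mul_zero]]
    simp
  rw [hS, add_zero, EP.eval_tailInteg, Kq_cast]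
  apply intervalIntegral.integral_congr
  intro u hu
  rw [uIcc_of_le hσ] at hu
  simp only [if_pos hu.2, hc, phiK_eval]

/-- Polynomial tail: `∫_σ^S c(u−σ) Φ_S(u) du = (tailInteg cE Φ_S S)(σ)`. -/
theorem tail_PhiPoly {cE : ES} {c : ℝ → ℝ} (hc : ∀ x, ES.eval cE x = c x) (σ : ℝ) :
    ∫ u in σ..Sc, c (u - σ) * PhiPoly u = EP.eval (EP.tailInteg cE phiS Sq) σ := by
  rw [EP.eval_tailInteg, Sq_cast]
  apply intervalIntegral.integral_congr
  intro u _
  simp only [hc, phiS_eval]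

/-- `∫_σ^S g(u−σ) Φ(u) du = (tailInteg g Φ_S S + tailInteg g Φ_K K)(σ)` for `0 ≤ σ ≤ K`. -/
theorem tail_Phi {σ : ℝ} (hσ0 : 0 ≤ σ) (hσ : σ ≤ Kc) :
    ∫ u in σ..Sc, gfun (u - σ) * Phi u =
      EP.eval (EP.tailInteg gE phiS Sq) σ + EP.eval (EP.tailInteg gE phiK Kq) σ := by
  have hfun : (fun u => gfun (u - σ) * Phi u) =
      fun u => gfun (u - σ) * PhiPoly u + gfun (u - σ) * (if u ≤ Kc then PhiCut u else 0) := by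
    funext u; rw [Phi_eq]; ring
  rw [hfun, intervalIntegral.integral_add, tail_PhiPoly gE_eval,
    tail_PhiCut gE_eval continuous_gfun hσ0 hσ]
  · exact ((continuous_gfun.comp (continuous_id.sub continuous_const)).mul
      continuous_PhiPoly).intervalIntegrable _ _
  · have hmeas : Measurable fun u : ℝ => if u ≤ Kc then PhiCut u else 0 :=
      Measurable.ite (measurableSet_le measurable_id measurable_const) continuous_PhiCut.measurable
        measurable_const
    have hbdd : ∃ C, 0 ≤ C ∧ ∀ x ∈ Icc 0 Sc, |(if x ≤ Kc then PhiCut x else 0)| ≤ C := by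
      obtain ⟨C, hC0, hC⟩ := exists_bound_Icc_of_continuous continuous_PhiCut 0 Sc
      refine ⟨C, hC0, fun x hx => ?_⟩
      split_ifs
      · exact hC x hx
      · simpa using hC0
    exact ii_cmul continuous_gfun hmeas hbdd σ hσ0 (hσ.trans Kc_le_Sc) le_rfl

/-! ### The first-coordinate integral `(F₀)_1` on `K·R_41` -/

/-- Interval integrability of `c(x) ψ(x + σ)` on `[0, S − σ]`. -/
theorem ii_shift {c ψ : ℝ → ℝ} (hcc : Continuous c) (hψ : Measurable ψ)
    (hψb : ∃ C, 0 ≤ C ∧ ∀ x ∈ Icc 0 Sc, |ψ x| ≤ C) {σ : ℝ} (hσ0 : 0 ≤ σ) (hσ : σ ≤ Sc) :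
    IntervalIntegrable (fun x => c x * ψ (x + σ)) volume 0 (Sc - σ) := by
  obtain ⟨C, hC0, hC⟩ := hψb
  obtain ⟨D, hD0, hD⟩ := exists_bound_Icc_of_continuous hcc 0 (Sc - σ)
  refine intervalIntegrable_of_bdd (f := fun x => c x * ψ (x + σ))
    (hcc.measurable.mul (hψ.comp (measurable_id.add_const σ))) (C := D * C) (by linarith) ?_
  intro x hx
  rw [abs_mul]
  exact mul_le_mul (hD x hx) (hC _ ⟨by linarith [hx.1], by linarith [hx.2]⟩) (abs_nonneg _) hD0

/-- On `K·R_41` the coordinate sum is `≥ 0`. -/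
theorem sum_nonneg_of_mem {t' : Fin 41 → ℝ} (ht' : t' ∈ scaledSimplex 41 Kc) : 0 ≤ ∑ j, t' j :=
  Finset.sum_nonneg fun j _ => ht'.1 j

/-- **Lemma 6.1(c), explicit form.**  For `t' ∈ K·R_41`:
`(F₀)_1(t') = Π_j g(t'_j) · (𝖠(σ') + 𝖡(σ') · Σ_l η(t'_l))` with `𝖠 = Pep`, `𝖡 = Qep` (paper eq. (Psi)). -/
theorem F0marg_eq {t' : Fin 41 → ℝ} (ht' : t' ∈ scaledSimplex 41 Kc) :
    F0marg t' = (∏ j, gfun (t' j)) *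
      (EP.eval Pep (∑ j, t' j) + EP.eval Qep (∑ j, t' j) * ∑ l, hfun (t' l) / gfun (t' l)) := by
  have hσ0 : 0 ≤ ∑ j, t' j := sum_nonneg_of_mem ht'
  have hσK : ∑ j, t' j ≤ Kc := ht'.2
  have hσS : ∑ j, t' j ≤ Sc := hσK.trans Kc_le_Sc
  set σ := ∑ j, t' j with hσdef
  set R' := ∑ l, hfun (t' l) / gfun (t' l) with hR'
  set Pg := ∏ j, gfun (t' j) with hPg
  unfold F0marg
  simp_rw [F0_cons _ t' ht'.1]
  rw [MeasureTheory.integral_indicator measurableSet_Icc, integral_Icc_eq_integral_Ioc,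
    ← integral_of_le (by linarith : (0 : ℝ) ≤ Sc - σ)]
  have i1 : IntervalIntegrable (fun x => gfun x * Phi (x + σ)) volume 0 (Sc - σ) :=
    ii_shift continuous_gfun measurable_Phi exists_bound_Phi hσ0 hσS
  have i2 : IntervalIntegrable (fun x => hfun x * chi (x + σ)) volume 0 (Sc - σ) :=
    ii_shift continuous_hfun measurable_chi exists_bound_chi hσ0 hσS
  have i3 : IntervalIntegrable (fun x => gfun x * chi (x + σ) * R') volume 0 (Sc - σ) :=
    (ii_shift continuous_gfun measurable_chi exists_bound_chi hσ0 hσS).mul_const R'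
  have hsplit : ∫ x in (0 : ℝ)..(Sc - σ),
      Pg * (gfun x * Phi (x + σ) + hfun x * chi (x + σ) + gfun x * chi (x + σ) * R') =
      Pg * ((∫ x in (0 : ℝ)..(Sc - σ), gfun x * Phi (x + σ)) +
        (∫ x in (0 : ℝ)..(Sc - σ), hfun x * chi (x + σ)) +
        (∫ x in (0 : ℝ)..(Sc - σ), gfun x * chi (x + σ)) * R') := by
    rw [intervalIntegral.integral_const_mul, intervalIntegral.integral_add (i1.add i2) i3,
      intervalIntegral.integral_add i1 i2, intervalIntegral.integral_mul_const]
  rw [hsplit, shift_integral gfun Phi σ, shift_integral hfun chi σ, shift_integral gfun chi σ,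
    tail_Phi hσ0 hσK, tail_chi hE_eval continuous_hfun hσ0 hσK,
    tail_chi gE_eval continuous_gfun hσ0 hσK]
  simp only [Pep, Qep, EP.eval_append]

/-! ### `J^K(F₀)` by classes -/

/-- A continuous function is a test function on every `[0, B]`. -/
theorem testFn_of_continuous {w : ℝ → ℝ} (hw : Continuous w) (B : ℝ) : TestFn B w := by
  obtain ⟨C, hC0, hC⟩ := exists_bound_Icc_of_continuous hw 0 B
  exact ⟨hw.measurable, C, hC0, hC⟩

/-- The weight `𝖠²` of `J^K(F₀)` is a test function on `[0, K]`. -/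
theorem testFn_P2 : TestFn Kc fun v => EP.eval Pep v ^ 2 :=
  testFn_of_continuous ((EP.continuous_eval Pep).pow 2) Kc

/-- The weight `𝖠𝖡` of `J^K(F₀)` is a test function on `[0, K]`. -/
theorem testFn_PQ : TestFn Kc fun v => EP.eval Pep v * EP.eval Qep v :=
  testFn_of_continuous ((EP.continuous_eval Pep).mul (EP.continuous_eval Qep)) Kc

/-- The weight `𝖡²` of `J^K(F₀)` is a test function on `[0, K]`. -/
theorem testFn_Q2 : TestFn Kc fun v => EP.eval Qep v ^ 2 :=
  testFn_of_continuous ((EP.continuous_eval Qep).pow 2) Kc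

/-- Pairing over `[0, K]` with a block-sum weight. -/
theorem pairing_K (D W : EP) (w : ℝ → ℝ) (hw : ∀ x ∈ Icc 0 Kc, w x = EP.eval W x) :
    ∫ v in (0 : ℝ)..Kc, EP.eval D v * w v = FS.eval (pairLo D W) := by
  rw [eval_pairLo_eq_integral, Rat.cast_zero, Kq_cast]
  apply intervalIntegral.integral_congr
  intro x hx
  rw [uIcc_of_le Kc_nonneg] at hx
  simp only [hw x hx]

/-- The four class integrals of `J^K` (`41 = 38 + 3` coordinates). -/
def VA' : ℝ := ∫ t, simplexIntegrand (38 + 2) (fun _ => GE) Kc (fun v => EP.eval Pep v ^ 2) t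
/-- Class-B integral of `J^K(F₀)`: one factor `gh`, weight `𝖠𝖡`, on `K·R_41`. -/
def VB' : ℝ := ∫ t, simplexIntegrand (38 + 2) (gB (38 + 1)) Kc (fun v => EP.eval Pep v * EP.eval Qep v) t
/-- Class-C integral of `J^K(F₀)`: one factor `h²`, weight `𝖡²`, on `K·R_41`. -/
def VC' : ℝ := ∫ t, simplexIntegrand (38 + 2) (gC (38 + 1)) Kc (fun v => EP.eval Qep v ^ 2) t
/-- Class-D integral of `J^K(F₀)`: two factors `gh`, weight `𝖡²`, on `K·R_41`. -/
def VD' : ℝ := ∫ t, simplexIntegrand (38 + 2) (gD 38) Kc (fun v => EP.eval Qep v ^ 2) t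

/-- **`J^K(F₀)` by symmetry classes** (§6.2): with
`(F₀)₁(t') = (Π g(t'_j))(𝖠(σ) + 𝖡(σ) Σ_l η(t'_l))`, `σ = Σ t'` (`F0marg_eq`), expanding the square
and collecting classes gives `J^K(F₀) = V'_A + 2·41 V'_B + 41 V'_C + 41·40 V'_D`. -/
theorem JKval_classes : JKval = VA' + 82 * VB' + 41 * VC' + 1640 * VD' := by
  have hF : ∀ t', (scaledSimplex 41 Kc).indicator (fun t' => F0marg t' ^ 2) t' =
      (scaledSimplex 41 Kc).indicator (fun t' => ((∏ j, gfun (t' j)) *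
        (EP.eval Pep (∑ j, t' j) + EP.eval Qep (∑ j, t' j) * ∑ l, hfun (t' l) / gfun (t' l))) ^ 2) t' := by
    intro t'
    by_cases ht' : t' ∈ scaledSimplex 41 Kc
    · rw [indicator_of_mem ht', indicator_of_mem ht', F0marg_eq ht']
    · rw [indicator_of_notMem ht', indicator_of_notMem ht']
  unfold JKval
  rw [← MeasureTheory.integral_indicator (measurableSet_scaledSimplex 41 Kc)]
  simp_rw [hF]
  refine (integral_classes (n := 38) Kc testFn_P2 testFn_PQ testFn_Q2).trans ?_
  rw [VA', VB', VC', VD']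
  push_cast
  ring

/-- Class A of `J^K` evaluated: `V'_A = ⟦pairLo G^{⋆41} 𝖠²⟧`. -/
theorem VA'_eq : VA' = FS.eval (pairLo D41 WP2) := by
  rw [VA', integral_simplex_eq_dens _ _ Kc Kc_nonneg _ testFn_P2, dens_const,
    show EP.convIter GE (38 + 2) (ES.toEP GE) = D41 from rfl, pairing_K D41 WP2]
  intro x _; rw [WP2, EP.eval_merge, EP.eval_mul, pow_two]

/-- Class B of `J^K` evaluated: `V'_B = ⟦pairLo (gh ⋆ G^{⋆40}) 𝖠𝖡⟧`. -/
theorem VB'_eq : VB' = FS.eval (pairLo (EP.conv GHE D40) WPQ) := by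
  rw [VB', gB, integral_simplex_eq_dens _ _ Kc Kc_nonneg _ testFn_PQ, dens_cons, dens_const,
    show EP.convIter GE (38 + 1) (ES.toEP GE) = D40 from rfl, pairing_K _ WPQ]
  intro x _; rw [WPQ, EP.eval_merge, EP.eval_mul]

/-- Class C of `J^K` evaluated: `V'_C = ⟦pairLo (h² ⋆ G^{⋆40}) 𝖡²⟧`. -/
theorem VC'_eq : VC' = FS.eval (pairLo (EP.conv H2E D40) WQ2) := by
  rw [VC', gC, integral_simplex_eq_dens _ _ Kc Kc_nonneg _ testFn_Q2, dens_cons, dens_const,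
    show EP.convIter GE (38 + 1) (ES.toEP GE) = D40 from rfl, pairing_K _ WQ2]
  intro x _; rw [WQ2, EP.eval_merge, EP.eval_mul, pow_two]

/-- Class D of `J^K` evaluated: `V'_D = ⟦pairLo (gh ⋆ gh ⋆ G^{⋆39}) 𝖡²⟧`. -/
theorem VD'_eq : VD' = FS.eval (pairLo (EP.conv GHE (EP.conv GHE (EP.convIter GE 38 (ES.toEP GE)))) WQ2) := by
  rw [VD', gD, integral_simplex_eq_dens _ _ Kc Kc_nonneg _ testFn_Q2, dens_cons, dens_cons, dens_const,
    pairing_K _ WQ2]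
  intro x _; rw [WQ2, EP.eval_merge, EP.eval_mul, pow_two]

/-- **`42·J^K(F₀)` in closed form, analytic half**: `42·J^K(F₀)` equals the explicit exp-polynomial
pairing expression `pairedJ` (paper Lemma 6.1(c) with §6.2; no literal data involved). -/
theorem JKval42_eq_pairedJ : 42 * JKval = pairedJ := by
  rw [JKval_classes, VA'_eq, VB'_eq, VC'_eq, VD'_eq, pairedJ]

end

end Summit.Parity.GeneralizedHardyLittlewood.Theorems.Dhl42.ClosedForm
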